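import Summits.HodgeConjecture.HodgeConjecture.Theorems.Ring2HypothesesDescentMotivatedStringTop
import Summits.HodgeConjecture.HodgeConjecture.Theorems.Ring2HypothesesDescentMotivatedUpperHalf
import Literature.AlgebraicGeometry.HodgeTheory.LefschetzStandardUnconditionalDegrees
import Literature.AlgebraicGeometry.HodgeTheory.ComplexOrientationFamily
import HarnessLib

/-!
# Ring 2 hypotheses, descent face — André's Prop. 2.2, Cor. 1 and Cor. 2 on the real carriers:
# `A_mot(X)_ℂ` is stable under the Lefschetz involution `*_η`, and the Lefschetz (primitive) components of a
# motivated class are motivated — unconditionally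

research route conditional on HC_CM; not a corollary; Q11.4-sentence-2 already refuted in dim ≥ 3.
Cell `pub-hodge-ring2` (Hodge ladder STAGE 3), seat `ring2-b05` (binder row b05
`Ring2.Hypotheses.MotivatedImpliesAlgebraicAV`), gen 36. `HC_CM` (`Theses.RankFourFaces.CMAbelianHodge`) does
not occur in this file; nothing here proves a case of the Hodge conjecture; the row b05 stays OPEN.

André 1996, Prop. 2.2 and its corollaries (p. 16): «L'algèbre `C_mot(X, X)` contient les involutions `*_L` et
`*_H` …»; Cor. 1 «L'ensemble `A_mot(X)_E` est stable sous `*`»; Cor. 2 «Posons `P_mot(X) = A_mot(X) ∩ P(X)` …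
on a la décomposition de Lefschetz `A_mot^j(X)_E = ⊕ Lᵏ P_mot^{j-2k}(X)_E`». On the real carriers
(`HodgeTheory.motivatedClasses n X p = A_motᵖ(X)_ℂ ⊆ H²ᵖ(X(ℂ); ℂ)`), for `X` smooth projective of dimension `n`
and ANY polarisation class `η` (`HodgeTheory.IsPolarizationClass`):

* §1 `primitivePart_mem_motivatedClasses` — **the primitive parts `ξ_{(2q,k)}(x)` of a motivated class `x` are
  motivated** (and so are all `Lᵃ ξ_{(2q,k)}(x)`, `lefschetzPowTo_primitivePart_mem_motivatedClasses`). Descending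
  induction on the Lefschetz index `k`: if the parts of `x` of index `> K` vanish and `p = ξ_{(2q,K)}(x)` has string
  length `l` (`2q + l = n`), then `L^{l-K} x = Lˡ p` (the lower components die past the tops of their strings),
  which is motivated (`Lefschetz` preserves `A_mot`), and the MOTIVATED correspondence `*_Θ(Δ_* Lˡ 1)` of
  `Theorems/Ring2HypothesesDescentMotivatedStringTop` sends it to `λ • p`, `λ ≠ 0`
  (`exists_corrClassAction_star_lefschetzPowTo_eq_smul`) and preserves `A_mot`
  (`corrClassAction_mem_motivatedClasses_of_motivated`, André's Corollaire p. 15); subtract `Lᴷ p` and recurse.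
  This replaces Kleiman's induction over string lengths (1.4.4–1.4.6) in André's proof: no isotypic projector and
  no Clebsch–Gordan coefficient is needed.
* §2 **`lefschetzInvolution_mem_motivatedClasses_of_mem` — PROP. 2.2 COR. 1: `*_η (A_motᵖ(X)_ℂ) ⊆ A_mot^{n-p}(X)_ℂ`**
  (`*_η (Lᵏ ξ) = Lˢ ξ` on each component).
* §3 consequences: the map form; `A_mot` is stable under `Lᵃ *_η Lᶜ` sandwiches; the hypothesis `hstar` of the
  tree's `lefschetzPowTo_primitivePart_mem_motivatedClasses_of_star` (gen 35) is discharged.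

No definition, no named fact, no sorry. References: Andre1996Motifs (Prop. 2.2, Cor. 1–2 p. 16; Corollaire p. 15;
Lemme 1.3.1 p. 13), Kleiman1968AlgebraicCycles (§1.4), VoisinHodgeI2002 (§6.2.3 Cor. 6.26), HatcherAT2002 (§3.3).
-/

noncomputable section

-- every declaration of this problem lives in `Summit.HodgeConjecture.HodgeConjecture.…` (summit = sub-problem)
set_option linter.dupNamespace false

open CategoryTheory AlgebraicGeometry MonoidalCategory CartesianMonoidalCategory
open Literature.AlgebraicTopology.SingularHomology Literature.Geometry.Kaehler
open Literature.AlgebraicGeometry Literature.AlgebraicGeometry.Motives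
  Literature.AlgebraicGeometry.HodgeTheory

namespace Summit.HodgeConjecture.HodgeConjecture.Theorems

variable {n : ℕ} {X : SchemeOver ℂ} {η : complexBetti X 2}

/-! ## §1 The primitive parts of a motivated class are motivated -/

/-- `Lʲ A_motˡ(X)_ℂ ⊆ A_motʳ(X)_ℂ`, `2l + 2j = 2r` (free spelling of the target codimension; the tree's
`Ring2.Hypotheses.lefschetzPowTo_mem_motivatedClasses_of_mem`). [cite: Andre1996Motifs, Prop. 2.1 (i) (p. 14)] -/
theorem lefschetzPowTo_mem_motivatedClasses_of_mem' (hX : IsSmoothProjective n X) (hη₁ : η ∈ algebraicClasses X 1)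
    (j l : ℕ) {r : ℕ} (hm : 2 * l + 2 * j = 2 * r) {c : complexBetti X (2 * l)} (hc : c ∈ motivatedClasses n X l) :
    lefschetzPowTo η j (2 * l) (2 * r) hm c ∈ motivatedClasses n X r := by
  obtain rfl : r = l + j := by omega
  exact Ring2.Hypotheses.lefschetzPowTo_mem_motivatedClasses_of_mem hX hη₁ j l hm hc

/-- **One string top.** For `x ∈ A_motᵇ(X)_ℂ` whose primitive parts of Lefschetz index `k > K` all vanish, and the
live index `(2q, K)` (`2q + 2K = 2b`, `2q + K ≤ n`): the primitive part `ξ_{(2q,K)}(x)` is motivated. With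
`2q + l = n` and `K + c = l`: `Lᶜ x = Lˡ ξ_{(2q,K)}(x)` is motivated, and the motivated correspondence
`*_Θ(Δ_* Lˡ 1)` (complex orientations) maps it to a non-zero multiple of `ξ_{(2q,K)}(x)` inside `A_mot^q(X)_ℂ`.
[cite: Andre1996Motifs, Prop. 2.2 (p. 16) and Corollaire (p. 15)] -/
theorem primitivePart_mem_motivatedClasses_of_top (hX : IsSmoothProjective n X) (hη : IsPolarizationClass n X η)
    {b : ℕ} {x : complexBetti X (2 * b)} (hx : x ∈ motivatedClasses n X b) {q K : ℕ} (hqK : 2 * q + 2 * K = 2 * b)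
    (hlive : 2 * q + K ≤ n)
    (hvanish : ∀ (q' k' : ℕ) (hqk' : 2 * q' + 2 * k' = 2 * b), K < k' →
      primitivePart η n hη.hasHardLefschetz (fun _ hm ↦ subsingleton_complexBetti hX hm) ⟨(2 * q', k'), hqk'⟩ x = 0) :
    primitivePart η n hη.hasHardLefschetz (fun _ hm ↦ subsingleton_complexBetti hX hm) ⟨(2 * q, K), hqK⟩ x ∈
      motivatedClasses n X q := by
  classical
  have hL : HasHardLefschetzProperty η n := hη.hasHardLefschetz
  have hvan : ∀ m, 2 * n < m → Subsingleton (complexBetti X m) := fun m hm ↦ subsingleton_complexBetti hX hm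
  have hXX : IsSmoothProjective (n + n) (X ⊗ X) := IsSmoothProjective.tensor_holds hX hX
  have hΘ := isPolarizationClass_boxSum hX hX hη hη
  have hp : primitivePart η n hL hvan ⟨(2 * q, K), hqK⟩ x ∈ primitiveClasses η n (2 * q) :=
    primitivePart_mem hL hvan ⟨(2 * q, K), hqK⟩ x
  -- the exponent `c` bringing `Lᴷ ξ` to the top of its string (`K + c = l`, `2q + l = n`)
  obtain ⟨c, hc⟩ : ∃ c, 2 * q + K + c = n := ⟨n - (2 * q + K), by omega⟩
  -- `Lᶜ x = L^{K+c} ξ`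
  have hLcx : lefschetzPowTo η c (2 * b) (2 * (b + c)) (by omega) x =
      lefschetzPowTo η (K + c) (2 * q) (2 * (b + c)) (by omega) (primitivePart η n hL hvan ⟨(2 * q, K), hqK⟩ x) := by
    conv_lhs => rw [← sum_lefschetzPowTo_primitivePart hL hvan x]
    rw [map_sum, Finset.sum_eq_single (⟨(2 * q, K), hqK⟩ : {P : ℕ × ℕ // P.1 + 2 * P.2 = 2 * b})]
    · exact lefschetzPowTo_lefschetzPowTo η c hqK _ _ _
    · rintro ⟨⟨a₁, k₁⟩, hP₁⟩ - hP
      dsimp only at hP₁ ⊢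
      by_cases hk : K < k₁
      · -- higher parts vanish by hypothesis
        obtain ⟨q', rfl⟩ : ∃ q', a₁ = 2 * q' := ⟨b - k₁, by omega⟩
        rw [hvanish q' k₁ hP₁ hk, map_zero, map_zero]
      · -- lower parts die past the tops of their strings
        have hlt : k₁ < K := by
          rcases Nat.lt_or_ge k₁ K with h | h
          · exact h
          · exfalso
            apply hP
            obtain rfl : k₁ = K := by omega
            obtain rfl : a₁ = 2 * q := by omega
            rfl
        rw [lefschetzPowTo_lefschetzPowTo η c hP₁ _ (by omega : a₁ + 2 * (k₁ + c) = 2 * (b + c)),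
          lefschetzPowTo_eq_zero_of_mem_primitiveClasses (primitivePart_mem hL hvan ⟨(a₁, k₁), hP₁⟩ x) _
            (show n + 1 ≤ a₁ + (k₁ + c) by omega)]
    · intro h
      exact absurd (Finset.mem_univ _) h
  -- `Lᶜ x` is motivated
  have hLcx_mot : lefschetzPowTo η (K + c) (2 * q) (2 * (b + c)) (by omega)
      (primitivePart η n hL hvan ⟨(2 * q, K), hqK⟩ x) ∈ motivatedClasses n X (b + c) := by
    rw [← hLcx]
    exact Ring2.Hypotheses.lefschetzPowTo_mem_motivatedClasses_of_mem hX hη.mem_algebraicClasses c b _ hx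
  -- the motivated correspondence `*_Θ(Δ_* Lˡ 1)`, complex orientations
  have hμ : (complexOrientationFamily hXX).HasPoincareDuality := hasPoincareDuality_complexOrientationFamily hXX
  have hν : (complexOrientationFamily hX).HasPoincareDuality := hasPoincareDuality_complexOrientationFamily hX
  obtain ⟨c₁, hc₁, hT⟩ := exists_corrClassAction_star_lefschetzPowTo_eq_smul hX hL hΘ.hasHardLefschetz
    (complexOrientationFamily hXX) (complexOrientationFamily hX) hμ hν
    (i := 2 * q) (l := K + c) (a := 2 * (b + c)) (N := 2 * (n + (K + c))) (by omega) (by omega)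
    (Nat.zero_add _) (by omega) (by omega) (by omega) (by omega) (by omega) hp
  -- its class is motivated: `*_Θ` of the ALGEBRAIC class `Δ_*(Lˡ 1)`
  have hz : lefschetzPowTo η (K + c) 0 (2 * (K + c)) (Nat.zero_add _) (singularCohomology.one ℂ (ComplexPoints X)) ∈
      algebraicClasses X (K + c) :=
    lefschetzPowTo_one_mem_algebraicClasses_of_mem hX hη.mem_algebraicClasses (K + c) _
  have hcalg : gysinMap (complexOrientationFamily hX) (complexOrientationFamily hXX)
      (AlgPoints.mapContinuous (L := ℂ) (lift (𝟙 X) (𝟙 X)))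
      (show 2 * (K + c) + 2 * (2 * q) = 2 * n by omega) (show 2 * (n + (K + c)) + 2 * (2 * q) = 2 * (n + n) by omega)
      (lefschetzPowTo η (K + c) 0 (2 * (K + c)) (Nat.zero_add _) (singularCohomology.one ℂ (ComplexPoints X))) ∈
      algebraicClasses (X ⊗ X) (n + (K + c)) :=
    gysinMap_mem_algebraicClasses_of_isSmoothProjective hX hXX _ _ hμ (lift (𝟙 X) (𝟙 X)) _ _ (by omega) hz
  have hu := lefschetzInvolution_mem_motivatedClasses hXX hΘ (show n + (K + c) + 2 * q = n + n by omega)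
    (show 2 * (n + (K + c)) + 2 * (2 * q) = 2 * (n + n) by omega) hcalg
  have hTmot := corrClassAction_mem_motivatedClasses_of_motivated hX hX (complexOrientationFamily hXX)
    (complexOrientationFamily hX) hμ hν (show 2 * (b + c) + 2 * (2 * q) = 2 * q + 2 * n by omega)
    (show 2 * q + 2 * (b + c) = 2 * n by omega) hu hLcx_mot
  rw [hT] at hTmot
  have h' := Submodule.smul_mem _ c₁⁻¹ hTmot
  rwa [inv_smul_smul₀ hc₁] at h'

/-- **The primitive parts of a motivated class are motivated** (André 1996, Prop. 2.2 Cor. 2 on the real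
carriers, unconditionally): for `X` smooth projective of dimension `n`, a polarisation class `η`, `x ∈ A_motᵇ(X)_ℂ`
and every Lefschetz index `(2q, k)`, `ξ_{(2q,k)}(x) ∈ A_mot^q(X)_ℂ`. Descending induction over the indices, one
string top at a time (`primitivePart_mem_motivatedClasses_of_top`), subtracting `Lᵏ ξ_{(2q,k)}(x)`.
[cite: Andre1996Motifs, Prop. 2.2 Cor. 2 (p. 16)] [cite: VoisinHodgeI2002, §6.2.3 Cor. 6.26] -/
theorem primitivePart_mem_motivatedClasses (hX : IsSmoothProjective n X) (hη : IsPolarizationClass n X η)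
    {b : ℕ} {x : complexBetti X (2 * b)} (hx : x ∈ motivatedClasses n X b) (q k : ℕ) (hqk : 2 * q + 2 * k = 2 * b) :
    primitivePart η n hη.hasHardLefschetz (fun _ hm ↦ subsingleton_complexBetti hX hm) ⟨(2 * q, k), hqk⟩ x ∈
      motivatedClasses n X q := by
  classical
  have hL : HasHardLefschetzProperty η n := hη.hasHardLefschetz
  have hvan : ∀ m, 2 * n < m → Subsingleton (complexBetti X m) := fun m hm ↦ subsingleton_complexBetti hX hm
  -- induction on a bound `K` at and above which all primitive parts vanish
  suffices key : ∀ (K : ℕ) (x : complexBetti X (2 * b)), x ∈ motivatedClasses n X b →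
      (∀ (q' k' : ℕ) (hqk' : 2 * q' + 2 * k' = 2 * b), K ≤ k' →
        primitivePart η n hL hvan ⟨(2 * q', k'), hqk'⟩ x = 0) →
      ∀ (q k : ℕ) (hqk : 2 * q + 2 * k = 2 * b),
        primitivePart η n hL hvan ⟨(2 * q, k), hqk⟩ x ∈ motivatedClasses n X q from
    key (b + 1) x hx (fun q' k' hqk' hk' ↦ absurd hqk' (by omega)) q k hqk
  intro K
  induction K with
  | zero =>
    intro x _ h0 q k hqk
    rw [h0 q k hqk (Nat.zero_le _)]
    exact Submodule.zero_mem _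
  | succ K IH =>
    intro x hx hK q k hqk
    by_cases hKb : b < K
    · exact IH x hx (fun q' k' hqk' _ ↦ absurd hqk' (by omega)) q k hqk
    obtain ⟨qs, hqs⟩ : ∃ qs, 2 * qs + 2 * K = 2 * b := ⟨b - K, by omega⟩
    -- the part of index `(2qs, K)` is motivated (zero if the index is not live)
    have hpmot : primitivePart η n hL hvan ⟨(2 * qs, K), hqs⟩ x ∈ motivatedClasses n X qs := by
      by_cases hlive : n < 2 * qs + K
      · rw [primitivePart_of_lt hL hvan _ hlive, LinearMap.zero_apply]
        exact Submodule.zero_mem _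
      · exact primitivePart_mem_motivatedClasses_of_top hX hη hx hqs (not_lt.1 hlive)
          (fun q' k' hqk' hk' ↦ hK q' k' hqk' hk')
    have hp : primitivePart η n hL hvan ⟨(2 * qs, K), hqs⟩ x ∈ primitiveClasses η n (2 * qs) :=
      primitivePart_mem hL hvan _ x
    -- subtract `Lᴷ ξ_{(2qs,K)}(x)`: the difference is motivated with parts vanishing from `K` on
    have hx' : x - lefschetzPowTo η K (2 * qs) (2 * b) hqs (primitivePart η n hL hvan ⟨(2 * qs, K), hqs⟩ x) ∈
        motivatedClasses n X b :=
      Submodule.sub_mem _ hx (lefschetzPowTo_mem_motivatedClasses_of_mem' hX hη.mem_algebraicClasses K qs hqs hpmot)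
    have hother : ∀ (P : {P : ℕ × ℕ // P.1 + 2 * P.2 = 2 * b}), P ≠ ⟨(2 * qs, K), hqs⟩ →
        primitivePart η n hL hvan P
            (x - lefschetzPowTo η K (2 * qs) (2 * b) hqs (primitivePart η n hL hvan ⟨(2 * qs, K), hqs⟩ x)) =
          primitivePart η n hL hvan P x := by
      intro P hP
      rw [map_sub, primitivePart_eq_zero_of_mem_ne hL hvan (Ne.symm hP) (lefschetzPowTo_mem_lefschetzSummand hqs hp),
        sub_zero]
    have hself : primitivePart η n hL hvan ⟨(2 * qs, K), hqs⟩
        (x - lefschetzPowTo η K (2 * qs) (2 * b) hqs (primitivePart η n hL hvan ⟨(2 * qs, K), hqs⟩ x)) = 0 := by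
      by_cases hlive : n < 2 * qs + K
      · rw [primitivePart_of_lt hL hvan _ hlive, LinearMap.zero_apply]
      · rw [map_sub, primitivePart_lefschetzPowTo_of_mem hL hvan _ (not_lt.1 hlive) hp, sub_self]
    have hK' : ∀ (q' k' : ℕ) (hqk' : 2 * q' + 2 * k' = 2 * b), K ≤ k' →
        primitivePart η n hL hvan ⟨(2 * q', k'), hqk'⟩
          (x - lefschetzPowTo η K (2 * qs) (2 * b) hqs (primitivePart η n hL hvan ⟨(2 * qs, K), hqs⟩ x)) = 0 := by
      intro q' k' hqk' hk'
      rcases Nat.lt_or_ge K k' with h | h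
      · have hne : (⟨(2 * q', k'), hqk'⟩ : {P : ℕ × ℕ // P.1 + 2 * P.2 = 2 * b}) ≠ ⟨(2 * qs, K), hqs⟩ := fun heq ↦ by
          have hk : k' = K := congrArg (fun P : {P : ℕ × ℕ // P.1 + 2 * P.2 = 2 * b} ↦ P.1.2) heq
          omega
        rw [hother _ hne, hK q' k' hqk' h]
      · obtain rfl : k' = K := by omega
        obtain rfl : q' = qs := by omega
        exact hself
    -- conclude for the given index
    by_cases hPk : k = K
    · subst hPk
      obtain rfl : q = qs := by omega
      exact hpmot
    · have hne : (⟨(2 * q, k), hqk⟩ : {P : ℕ × ℕ // P.1 + 2 * P.2 = 2 * b}) ≠ ⟨(2 * qs, K), hqs⟩ := fun heq ↦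
        hPk (congrArg (fun P : {P : ℕ × ℕ // P.1 + 2 * P.2 = 2 * b} ↦ P.1.2) heq)
      rw [← hother ⟨(2 * q, k), hqk⟩ hne]
      exact IH _ hx' hK' q k hqk

/-- **All `Lᵃ ξ_{(2q,k)}(x)` of a motivated `x` are motivated** (Prop. 2.2 Cor. 2 with Prop. 2.1: `Lᵃ` preserves
`A_mot`). The unconditional form of the tree's `lefschetzPowTo_primitivePart_mem_motivatedClasses_of_star` (gen 35).
[cite: Andre1996Motifs, Prop. 2.2 Cor. 2 (p. 16) and Prop. 2.1 (i) (p. 14)] -/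
theorem lefschetzPowTo_primitivePart_mem_motivatedClasses (hX : IsSmoothProjective n X)
    (hη : IsPolarizationClass n X η) {b : ℕ} {x : complexBetti X (2 * b)} (hx : x ∈ motivatedClasses n X b)
    (q k : ℕ) (hqk : 2 * q + 2 * k = 2 * b) (a' : ℕ) {r : ℕ} (hr : 2 * q + 2 * a' = 2 * r) :
    lefschetzPowTo η a' (2 * q) (2 * r) hr
        (primitivePart η n hη.hasHardLefschetz (fun _ hm ↦ subsingleton_complexBetti hX hm) ⟨(2 * q, k), hqk⟩ x) ∈
      motivatedClasses n X r :=
  lefschetzPowTo_mem_motivatedClasses_of_mem' hX hη.mem_algebraicClasses a' q hr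
    (primitivePart_mem_motivatedClasses hX hη hx q k hqk)

/-! ## §2 Prop. 2.2 Cor. 1: `A_mot(X)_ℂ` is stable under `*_η` -/

/-- **André 1996, Prop. 2.2 Cor. 1 on the real carriers: `*_η (A_motᵖ(X)_ℂ) ⊆ A_mot^{p'}(X)_ℂ`** (`p + p' = n`) for
every smooth projective complex `X` of dimension `n`, every polarisation class `η` of `X`
(`HodgeTheory.IsPolarizationClass`) and André's sign-free Lefschetz involution `*_η` (`HodgeTheory.lefschetzInvolution`)
— unconditionally («L'ensemble `A_mot(X)_E` est stable sous `*`»). Proof: `x = Σ Lᵏ ξ_{(2q,k)}(x)`, `*_η (Lᵏ ξ) =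
Lˢ ξ` (`2q + k + s = n`), and each `Lˢ ξ_{(2q,k)}(x)` is motivated (`lefschetzPowTo_primitivePart_mem_motivatedClasses`).
[cite: Andre1996Motifs, Prop. 2.2 Cor. 1 (p. 16) and §1.1 (p. 10)] -/
theorem lefschetzInvolution_mem_motivatedClasses_of_mem (hX : IsSmoothProjective n X)
    (hη : IsPolarizationClass n X η) {p p' : ℕ} (h : 2 * p + 2 * p' = 2 * n) {x : complexBetti X (2 * p)}
    (hx : x ∈ motivatedClasses n X p) :
    lefschetzInvolution hη.hasHardLefschetz h x ∈ motivatedClasses n X p' := by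
  classical
  have hL : HasHardLefschetzProperty η n := hη.hasHardLefschetz
  have hvan : ∀ m, 2 * n < m → Subsingleton (complexBetti X m) := fun m hm ↦ subsingleton_complexBetti hX hm
  rw [← sum_lefschetzPowTo_primitivePart hL hvan x, map_sum]
  refine Submodule.sum_mem _ fun P _ ↦ ?_
  obtain ⟨⟨a₁, k₁⟩, hP₁⟩ := P
  dsimp only at hP₁ ⊢
  by_cases hlive : n < a₁ + k₁
  · rw [primitivePart_of_lt hL hvan _ hlive, LinearMap.zero_apply, map_zero, map_zero]
    exact Submodule.zero_mem _
  · obtain ⟨q, rfl⟩ : ∃ q, a₁ = 2 * q := ⟨p - k₁, by omega⟩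
    obtain ⟨s, hs⟩ : ∃ s, 2 * q + k₁ + s = n := ⟨n - (2 * q + k₁), by omega⟩
    rw [lefschetzInvolution_lefschetzPowTo_eq hL hs hP₁ h (show 2 * q + 2 * s = 2 * p' by omega)]
    exact lefschetzPowTo_primitivePart_mem_motivatedClasses hX hη hx q k₁ hP₁ s _

/-- `*_η (*_η x) = x` with free spellings of the two degrees `a + b = 2d` (the tree's
`lefschetzInvolution_lefschetzInvolution_of_le` / `_of_ge`). [cite: Andre1996Motifs, §1.1 (p. 10)] -/
theorem lefschetzInvolution_lefschetzInvolution_eq {Y : SchemeOver ℂ} {κ : complexBetti Y 2} {d : ℕ}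
    (hL : HasHardLefschetzProperty κ d) {a b : ℕ} (hab : a + b = 2 * d) (hba : b + a = 2 * d) (x : complexBetti Y a) :
    lefschetzInvolution hL hba (lefschetzInvolution hL hab x) = x := by
  rcases le_or_gt a d with hle | hlt
  · obtain ⟨j, hj⟩ : ∃ j, a + j = d := ⟨d - a, by omega⟩
    obtain rfl : b = a + 2 * j := by omega
    exact lefschetzInvolution_lefschetzInvolution_of_le hL hj hab hba x
  · obtain ⟨j, hj⟩ : ∃ j, b + j = d := ⟨d - b, by omega⟩
    obtain rfl : a = b + 2 * j := by omega
    exact lefschetzInvolution_lefschetzInvolution_of_ge hL hj hab hba x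

/-- Subspace form of Cor. 1: `*_η` maps `A_motᵖ(X)_ℂ` into `A_mot^{p'}(X)_ℂ` (`p + p' = n`).
[cite: Andre1996Motifs, Prop. 2.2 Cor. 1 (p. 16)] -/
theorem map_lefschetzInvolution_motivatedClasses_le (hX : IsSmoothProjective n X) (hη : IsPolarizationClass n X η)
    {p p' : ℕ} (h : 2 * p + 2 * p' = 2 * n) :
    (motivatedClasses n X p).map (lefschetzInvolution hη.hasHardLefschetz h) ≤ motivatedClasses n X p' := by
  rintro _ ⟨x, hx, rfl⟩
  exact lefschetzInvolution_mem_motivatedClasses_of_mem hX hη h hx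

/-- **`*_η` restricts to a bijection `A_motᵖ(X)_ℂ → A_mot^{p'}(X)_ℂ`** (`p + p' = n`): the image IS `A_mot^{p'}`, since
`*_η ∘ *_η = id`. [cite: Andre1996Motifs, Prop. 2.2 Cor. 1 (p. 16) and §1.1 (p. 10)] -/
theorem map_lefschetzInvolution_motivatedClasses_eq (hX : IsSmoothProjective n X) (hη : IsPolarizationClass n X η)
    {p p' : ℕ} (h : 2 * p + 2 * p' = 2 * n) :
    (motivatedClasses n X p).map (lefschetzInvolution hη.hasHardLefschetz h) = motivatedClasses n X p' := by
  refine le_antisymm (map_lefschetzInvolution_motivatedClasses_le hX hη h) fun y hy ↦ ?_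
  have h' : 2 * p' + 2 * p = 2 * n := by omega
  exact ⟨lefschetzInvolution hη.hasHardLefschetz h' y, lefschetzInvolution_mem_motivatedClasses_of_mem hX hη h' hy,
    lefschetzInvolution_lefschetzInvolution_eq hη.hasHardLefschetz h' h y⟩

/-- `Lʲ (*_η y) = y` above the middle degree (`b + j = d`), with a free spelling `m` of the degree `b + 2j` of `y`
(bookkeeping form of `HodgeTheory.lefschetzPow_lefschetzInvolution`). [cite: Andre1996Motifs, §1.1 (p. 10)] -/
theorem lefschetzPowTo_lefschetzInvolution_eq {Y : SchemeOver ℂ} {κ : complexBetti Y 2} {d : ℕ}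
    (hL : HasHardLefschetzProperty κ d) {b j m : ℕ} (hj : b + j = d) (hm : b + 2 * j = m) (hab : m + b = 2 * d)
    (y : complexBetti Y m) : lefschetzPowTo κ j b m hm (lefschetzInvolution hL hab y) = y := by
  subst hm
  exact lefschetzPow_lefschetzInvolution hL hj hab y

/-- **The motivated analogue of Grothendieck's `A(X)` (b), unconditionally**: for `2p + j = n` the hard-Lefschetz
isomorphism `Lʲ : H²ᵖ(X(ℂ); ℂ) → H^{2(p+j)}(X(ℂ); ℂ)` restricts to a BIJECTION `A_motᵖ(X)_ℂ → A_mot^{p+j}(X)_ℂ`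
(André's formalism is built so that `B`, hence `A`, holds for motivated correspondences: «l'idée clé … est
d'adjoindre formellement cette involution», §0.2): into by Prop. 2.1, onto because `y = Lʲ (*_η y)` with `*_η y`
motivated (Cor. 1). [cite: Andre1996Motifs, §0.2 (p. 7) and Prop. 2.2 Cor. 1 (p. 16)] [cite: Grothendieck1968, §3 p. 196 (A(X))] -/
theorem bijOn_lefschetzPowTo_motivatedClasses (hX : IsSmoothProjective n X) (hη : IsPolarizationClass n X η)
    {p j : ℕ} (hpj : 2 * p + j = n) (hm : 2 * p + 2 * j = 2 * (p + j)) :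
    Set.BijOn (lefschetzPowTo η j (2 * p) (2 * (p + j)) hm) (motivatedClasses n X p) (motivatedClasses n X (p + j)) := by
  refine ⟨fun x hx ↦ Ring2.Hypotheses.lefschetzPowTo_mem_motivatedClasses_of_mem hX hη.mem_algebraicClasses j p hm hx,
    (injective_lefschetzPowTo_of_le η n hη.hasHardLefschetz (by omega) hm).injOn, fun y hy ↦ ?_⟩
  have h' : 2 * (p + j) + 2 * p = 2 * n := by omega
  refine ⟨lefschetzInvolution hη.hasHardLefschetz h' y, lefschetzInvolution_mem_motivatedClasses_of_mem hX hη h' hy, ?_⟩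
  exact lefschetzPowTo_lefschetzInvolution_eq hη.hasHardLefschetz hpj hm h' y

/-- **Lefschetz decomposition inside `A_mot`** (Cor. 2, membership form): a class `x ∈ H²ᵇ(X(ℂ); ℂ)` is motivated iff
all its primitive parts `ξ_{(2q,k)}(x)` are. [cite: Andre1996Motifs, Prop. 2.2 Cor. 2 (p. 16)] -/
theorem mem_motivatedClasses_iff_forall_primitivePart_mem (hX : IsSmoothProjective n X) (hη : IsPolarizationClass n X η)
    {b : ℕ} (x : complexBetti X (2 * b)) :
    x ∈ motivatedClasses n X b ↔ ∀ (q k : ℕ) (hqk : 2 * q + 2 * k = 2 * b),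
      primitivePart η n hη.hasHardLefschetz (fun _ hm ↦ subsingleton_complexBetti hX hm) ⟨(2 * q, k), hqk⟩ x ∈
        motivatedClasses n X q := by
  classical
  refine ⟨fun hx q k hqk ↦ primitivePart_mem_motivatedClasses hX hη hx q k hqk, fun h ↦ ?_⟩
  have hL : HasHardLefschetzProperty η n := hη.hasHardLefschetz
  have hvan : ∀ m, 2 * n < m → Subsingleton (complexBetti X m) := fun m hm ↦ subsingleton_complexBetti hX hm
  rw [← sum_lefschetzPowTo_primitivePart hL hvan x]
  refine Submodule.sum_mem _ fun P _ ↦ ?_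
  obtain ⟨⟨a₁, k₁⟩, hP₁⟩ := P
  dsimp only at hP₁ ⊢
  by_cases hlive : n < a₁ + k₁
  · rw [primitivePart_of_lt hL hvan _ hlive, LinearMap.zero_apply, map_zero]
    exact Submodule.zero_mem _
  · obtain ⟨q, rfl⟩ : ∃ q, a₁ = 2 * q := ⟨b - k₁, by omega⟩
    exact lefschetzPowTo_mem_motivatedClasses_of_mem' hX hη.mem_algebraicClasses k₁ q hP₁ (h q k₁ hP₁)

end Summit.HodgeConjecture.HodgeConjecture.Theorems

end
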